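import Summits.AtomisticToContinuum.HydrodynamicLimit.Theorems.CollisionIsometryCLTCollisionalTransferLocalityRhsAConeConst
import Summits.AtomisticToContinuum.HydrodynamicLimit.Theorems.CollisionIsometryCLTCollisionalTransferLocalityBlockDensityLLNConst
import Summits.AtomisticToContinuum.HydrodynamicLimit.Theorems.CollisionIsometryCLTCollisionalTransferLocalityBlockVelocityLLNConst
import Summits.AtomisticToContinuum.HydrodynamicLimit.Theorems.CollisionIsometryCLTCollisionalTransferLocalityConstLLNOfParts
import HarnessLib

/-!
# The value `RhsA` at global equilibrium for the mesoscale kernel: a non-zero deterministic limit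
(registered stub [R0A] `stub_rhsA_const`, line `hemisphere-affine-slaving`, crux `CollisionalTransferLocality`,
stmt-AtomisticToContinuum-9518; `--supports` helper file)

Under the flow-invariant homogeneous local Gibbs law `G_N` (activity `1`, velocity `0`, temperature `θ`) the
Euler value `RhsA(τ) = ∫₀^τ∫ₓ tr A · p_c(ρ̄, θ̄)` of a matrix weight `A` smooth on `[0, t]`, read through an
ADMISSIBLE (mesoscale) kernel family, converges in probability at each FIXED `τ ∈ [0, t]` to
`θ (Z(σ³) − 1) ∫₀^τ∫ₓ tr A`, for every reduced density below a radius depending on `θ` only. This is the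
generic-kernel theorem `rhsA_tendsto_of_constLLN` (module `…RhsAConeConst`: any continuous nonnegative mass-one
kernel family + the constant-profile mesoscopic LLN at time `0` + the all-times dilute ceiling ⇒ the fixed-time
law of `RhsA`, by stationarity `map_flow_localGibbsLaw_const`, the deterministic smallness of the centred slice
`abs_integral_weight_pcoll_sub_le_of_lln`, the velocity-moment envelope and `tendsto_measure_setIntegral_of_forall`)
fed with its two inputs for admissible kernels: the constant-profile block LLN assembled from its parts
(`stub_blockDensityLLNConst`, `stub_blockVelocityLLNConst`, `stub_constLLN_of_parts`) and the dilute ceiling at all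
times (`ceilingAllTimes_const`), at a dilute level `η₁ ≤ η_Z, η_c/2` inside the linear window and the continuity
interval of the compressibility factor (`stub_hsCompressibility_linear`, `hsCompressibility_continuousOn`).
Folklore; nothing is cited (Chapman–Cowling 1970 §16.4 is the background for the collisional pressure).
-/

namespace Summit.AtomisticToContinuum.HydrodynamicLimit.Theorems.HemisphereAffineSlaving

open scoped BigOperators Topology Classical ENNReal InnerProductSpace
open Filter Set Function MeasureTheory

noncomputable section

open Literature.MathematicalPhysics.KineticTheory (T3 V3 hsCompressibility)

/-- **Registered stub [R0A] `stub_rhsA_const` (the value `RhsA` at global equilibrium; line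
hemisphere-affine-slaving, crux stmt-AtomisticToContinuum-9518).** For every `θ > 0` there is `σ₀ > 0` such
that under the homogeneous local Gibbs law (activity `1`, velocity `0`, temperature `θ`) at `σ < σ₀`, for every
flow family, horizon `t > 0`, admissible kernel family, matrix weight `A` smooth on `[0, t]` and FIXED
`τ ∈ [0, t]`: `RhsA(τ) = ∫₀^τ∫ₓ tr A · p_c(ρ̄, θ̄) → θ (Z(σ³) − 1) ∫₀^τ∫ₓ tr A` in probability
(`rhsA_tendsto_of_constLLN` with the block LLN `stub_constLLN_of_parts` of `stub_blockDensityLLNConst`,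
`stub_blockVelocityLLNConst`, and the ceiling `ceilingAllTimes_const`; radius
`σ₀ = min (σ_LLN, σ_ceiling(η₁), η₁, 1/2)` with `η₁ = min (η_Z, η_c/2)`). [folklore] -/
theorem stub_rhsA_const : ∀ θ : ℝ, 0 < θ → ∃ σ₀ : ℝ, 0 < σ₀ ∧ ∀ σ : ℝ, 0 < σ → σ < σ₀ → ∀ (Φ : Flows σ) (t : ℝ), 0 < t → ∀ (γ C : ℝ) (φ : ℕ → T3 → ℝ), 0 < γ → γ ≤ 1 / 15 → AdmissibleKernel γ C φ → ∀ (A : ℝ → T3 → Fin 3 → Fin 3 → ℝ), SmoothMatrixOn (Icc 0 t) A → ∀ τ ∈ Icc 0 t, ∀ δ : ℝ, 0 < δ → Tendsto (fun N : ℕ => Literature.MathematicalPhysics.KineticTheory.localGibbsLaw σ (fun _ => 1) (fun _ => 0) (fun _ => θ) N (Φ N) {z | δ < |RhsA σ Φ φ A N z τ - θ * (Literature.MathematicalPhysics.KineticTheory.hsCompressibility (σ ^ 3) - 1) * ∫ s in Icc 0 τ, ∫ x, trW A s x|}) atTop (𝓝 0) := by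
  intro θ hθ
  -- the dilute level `η₁`: inside the linear window and the continuity interval of `Z`
  obtain ⟨ηZ, hηZ, K, hK, hZK⟩ := stub_hsCompressibility_linear
  obtain ⟨ηc, hηc, hZc⟩ := hsCompressibility_continuousOn
  obtain ⟨η₁, hη₁0, hη₁Z, hη₁c⟩ : ∃ η₁ : ℝ, 0 < η₁ ∧ η₁ ≤ ηZ ∧ η₁ ≤ ηc / 2 :=
    ⟨min ηZ (ηc / 2), lt_min hηZ (half_pos hηc), min_le_left _ _, min_le_right _ _⟩
  -- radii: block-density LLN, all-times dilute ceiling, `σ³ ≤ η₁`, `σ ≤ 1/2`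
  obtain ⟨σL, hσL, HL⟩ := stub_blockDensityLLNConst
  obtain ⟨σS, hσS, HS⟩ := ceilingAllTimes_const η₁ hη₁0 θ hθ
  refine ⟨min (min σL σS) (min η₁ (1 / 2)), lt_min (lt_min hσL hσS) (lt_min hη₁0 (by norm_num)), ?_⟩
  intro σ hσ hlt Φ t ht γ C φ hγ hγ' hadm A hA τ hτ δ hδ
  have hltL : σ < σL := lt_of_lt_of_le hlt ((min_le_left _ _).trans (min_le_left _ _))
  have hltS : σ < σS := lt_of_lt_of_le hlt ((min_le_left _ _).trans (min_le_right _ _))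
  have hση : σ ≤ η₁ := (lt_of_lt_of_le hlt ((min_le_right _ _).trans (min_le_left _ _))).le
  have hhalf : σ ≤ 1 / 2 := (lt_of_lt_of_le hlt ((min_le_right _ _).trans (min_le_right _ _))).le
  have hσ3 : σ ^ 3 ≤ η₁ := by nlinarith [sq_nonneg σ, hσ.le]
  have hcontZ : ContinuousAt hsCompressibility (σ ^ 3) :=
    hZc.continuousAt (Icc_mem_nhds (by positivity) (by nlinarith [sq_nonneg σ, hσ.le]))
  obtain ⟨hsm, hφ0, hφ1, -, -, -⟩ := id hadm
  have hφc : ∀ N, Continuous (φ N) := fun N => (hsm N).continuous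
  -- the generic-kernel theorem, fed with the block LLN of admissible kernels and the dilute ceiling
  exact rhsA_tendsto_of_constLLN hθ hσ hhalf hK hη₁0 hη₁Z (hσ3.trans hη₁Z) hZK hcontZ Φ ht hφc hφ0 hφ1
    (stub_constLLN_of_parts σ θ Φ φ hφc (HL σ hσ hltL θ hθ Φ γ C φ hγ hγ' hadm)
      (stub_blockVelocityLLNConst σ hσ hhalf θ hθ Φ γ C φ hγ hγ' hadm))
    (HS σ hσ hltS Φ t ht γ C φ hγ hγ' hadm) hA hτ hδ
end

end Summit.AtomisticToContinuum.HydrodynamicLimit.Theorems.HemisphereAffineSlaving
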